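import Summits.NavierStokesRegularity.NavierStokesRegularity.Theses.DssFarFieldSlaving
import Literature.Analysis.FluidPDE.KNSSThm53OfWindow
import Literature.Analysis.FluidPDE.AxisymmetricEuler
import HarnessLib

/-!
# The axisymmetric sub-class of the Type-I rotated-DSS profile class is EMPTY
  (route `DssFarFieldSlaving`, crux `BlowupTypeIDssProfile`, stmt-NavierStokesRegularity-0155 —
  SUPPORT: a certified-empty sub-class, not a proof or refutation of the crux)

The crux asks for `(c, R, u)` with `1 < c`, `u` an ancient mild solution (`ν = 1`, duality form)
with measurable slices, rotated `c`-DSS for the isometry `R`, Type-I bounded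
`‖u(t,x)‖ ≤ C₀/(‖x‖ + √(−t))`, not a.e. trivial.  This file proves from the tree's DISCHARGED
Liouville theorem `knss_bound_C_over_r_holds` (Koch–Nadirashvili–Seregin–Šverák 2009, Thm 5.3: a
bounded ancient mild solution with axisymmetric slices and `r‖u‖ ≤ C` vanishes) that NO such object
has axisymmetric slices (about the `e₃`-axis; `IsAxisymmetric`, with or without swirl), for ANY
`c` and ANY `R` — indeed without using the self-similarity at all:

* `typeI_ancient_axisymmetric_ae_zero` — an ancient mild solution with measurable, axisymmetric
  slices and a Type-I bound is a.e. zero on every slice `t < 0`.  Proof: the Type-I bound gives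
  `cylRadius x · ‖u(t,x)‖ ≤ ‖x‖ · C₀/(‖x‖ + √(−t)) ≤ C₀`; the time-shifted field `τ ↦ u(τ + t/2)` is
  a BOUNDED ancient mild solution (bound `C₀/√(−t/2)`) with the same properties, so KNSS Thm 5.3
  applies to it, and its slice at `τ = t/2` is `u(t)`.
* `rotatedTypeIDSSLiouville_of_axisymmetric` — consequently Tsai's rotated Type-I `λ`-DSS
  Liouville statement holds on the axisymmetric sub-class, for every `c` and `R`;
* `rdssClass_axisymmetric_empty` — the `∃`-class of the truncation bridges
  (`filamentSkeletonRss_rdssProfileTruncation_proof`, `dssTruncationBridgeTypeI_proof`) has no member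
  with axisymmetric slices.

This is the mechanism of Seregin–Šverák 2009 ("axisymmetric singularities are of Type II"; tree
barrier `Literature.Barriers.NavierStokesRegularity.AxisymmetricTypeIExclusion`), here in the
global ancient form needed by the object search of cell pub-ns-dss: an axisymmetric solver class is
a certified-empty negative control, never a candidate class.  Other symmetry axes reduce to `e₃` by
conjugating `u` with a rotation; that reduction is not formalised here.

## References

* G. Koch, N. Nadirashvili, G. Seregin, V. Šverák, Acta Math. 203 (2009) 83–105 = arXiv:0709.3599,
  Theorem 5.3 and (1.6). [KochNadirashviliSereginSverak2009]
* G. Seregin, V. Šverák, Comm. PDE 34 (2009) 171–201, Thm 1.1 and §1. [SereginSverak2009]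
* Z. Bradshaw, T.-P. Tsai, Comm. PDE 42 (2017) = arXiv:1610.05680, §5 Open Problem 5.1.
  [BradshawTsai2017CPDE]
-/

noncomputable section

set_option linter.dupNamespace false

namespace Summit.NavierStokesRegularity.NavierStokesRegularity.Theorems

open MeasureTheory Set Function Literature.Analysis.FluidPDE

/-- **Type-I ancient mild solutions with axisymmetric slices are trivial** (KNSS 2009, Thm 5.3,
through a time shift): if `u` is an ancient mild solution (`ν = 1`) with measurable slices, every
slice `u t`, `t < 0`, is axisymmetric about `e₃`, and `‖u(t,x)‖ ≤ C₀/(‖x‖ + √(−t))`, then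
`u t = 0` a.e. for every `t < 0`.  The Type-I bound implies `cylRadius x · ‖u(t,x)‖ ≤ C₀`, and
after the shift `τ ↦ u(τ + t/2)` the field is bounded on `(−∞, 0)`, so the tree's discharged
`knss_bound_C_over_r_holds` applies. [cite: KochNadirashviliSereginSverak2009, Thm 5.3] -/
theorem typeI_ancient_axisymmetric_ae_zero {u : ℝ → EuclideanSpace ℝ (Fin 3) → EuclideanSpace ℝ (Fin 3)} {C₀ : ℝ}
    (hmild : IsAncientMildSolution 1 u) (hmeas : ∀ t < 0, AEStronglyMeasurable (u t) volume)
    (hTI : HasTypeIDecay C₀ u) (hax : ∀ t < 0, IsAxisymmetric (u t)) :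
    ∀ t < 0, u t =ᵐ[volume] 0 := by
  intro t ht
  -- the Type-I constant is nonnegative
  have hC₀ : 0 ≤ C₀ := by
    have h1 := hTI t ht 0
    have hs : 0 < Real.sqrt (-t) := Real.sqrt_pos.2 (by linarith)
    rw [norm_zero, zero_add] at h1
    by_contra hneg
    have h2 : C₀ / Real.sqrt (-t) < 0 := div_neg_of_neg_of_pos (lt_of_not_ge hneg) hs
    linarith [norm_nonneg (u t 0)]
  -- the shifted field `v τ = u (τ + t/2)`
  set v : ℝ → EuclideanSpace ℝ (Fin 3) → EuclideanSpace ℝ (Fin 3) := fun τ => u (τ + t / 2) with hv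
  have hshift : ∀ τ : ℝ, τ < 0 → τ + t / 2 < 0 := fun τ hτ => by linarith
  have hv_mild : IsAncientMildSolution 1 v := hmild.time_translate (s := t / 2) (by linarith)
  -- bounded on `(-∞, 0)` by `C₀ / √(-t/2)`
  have hv_bdd : IsBoundedOn (Iio 0) v := by
    obtain ⟨K, hK⟩ := (hTI.hasTypeITimeDecay hC₀).isBoundedOn hC₀ (δ := -(t / 2)) (by linarith)
    refine ⟨K, fun τ hτ x => hK (τ + t / 2) ?_ x⟩
    simp only [mem_Iio] at hτ ⊢
    linarith
  have hv_meas : ∀ τ < 0, AEStronglyMeasurable (v τ) volume := fun τ hτ => hmeas _ (hshift τ hτ)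
  have hv_ax : ∀ τ < 0, IsAxisymmetric (v τ) := fun τ hτ => hax _ (hshift τ hτ)
  -- the `C/r` bound from the Type-I bound
  have hcyl : ∀ x : EuclideanSpace ℝ (Fin 3), cylRadius x ≤ ‖x‖ := by
    intro x
    rw [cylRadius, EuclideanSpace.norm_eq]
    apply Real.sqrt_le_sqrt
    simp only [Fin.sum_univ_three, Real.norm_eq_abs, sq_abs]
    nlinarith [sq_nonneg (x 2)]
  have hv_bound : ∃ C : ℝ, ∀ τ < 0, ∀ x, cylRadius x * ‖v τ x‖ ≤ C := by
    refine ⟨C₀, fun τ hτ x => ?_⟩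
    have hτ' : τ + t / 2 < 0 := hshift τ hτ
    have hs : 0 < Real.sqrt (-(τ + t / 2)) := Real.sqrt_pos.2 (by linarith)
    have hden : 0 < ‖x‖ + Real.sqrt (-(τ + t / 2)) := by positivity
    have h1 : ‖v τ x‖ ≤ C₀ / (‖x‖ + Real.sqrt (-(τ + t / 2))) := hTI _ hτ' x
    calc cylRadius x * ‖v τ x‖ ≤ ‖x‖ * (C₀ / (‖x‖ + Real.sqrt (-(τ + t / 2)))) :=
          mul_le_mul (hcyl x) h1 (norm_nonneg _) (norm_nonneg _)
      _ = C₀ * (‖x‖ / (‖x‖ + Real.sqrt (-(τ + t / 2)))) := by ring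
      _ ≤ C₀ * 1 := by
          gcongr
          rw [div_le_one hden]
          linarith [hs.le]
      _ = C₀ := mul_one _
  -- KNSS 2009, Thm 5.3 (discharged in the tree) for the shifted field, read at `τ = t/2`
  have key := knss_bound_C_over_r_holds ⟨hv_mild, hv_bdd⟩ hv_meas hv_ax hv_bound (t / 2) (by linarith)
  have e : v (t / 2) = u t := by simp only [hv, add_halves]
  rwa [e] at key

/-- **Tsai's rotated Type-I `λ`-DSS Liouville statement holds on the axisymmetric sub-class**, for
every factor `c` and every linear isometry `R` (the rotated-DSS hypothesis is not even used).
[cite: KochNadirashviliSereginSverak2009, Thm 5.3] -/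
theorem rotatedTypeIDSSLiouville_of_axisymmetric (c : ℝ) (R : EuclideanSpace ℝ (Fin 3) ≃ₗᵢ[ℝ] EuclideanSpace ℝ (Fin 3)) (u : ℝ → EuclideanSpace ℝ (Fin 3) → EuclideanSpace ℝ (Fin 3))
    (hax : ∀ t < 0, IsAxisymmetric (u t)) :
    1 < c → IsAncientMildSolution 1 u → (∀ t < 0, AEStronglyMeasurable (u t) volume) →
      IsRotatedDSS c R u → (∃ C₀ : ℝ, HasTypeIDecay C₀ u) → ∀ t < 0, u t =ᵐ[volume] 0 := by
  rintro - hmild hmeas - ⟨C₀, hTI⟩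
  exact typeI_ancient_axisymmetric_ae_zero hmild hmeas hTI hax

/-- **The axisymmetric sub-class of the Type-I rotated-DSS profile class is empty**: there is no
`(c, R, u)` in the hypothesis class of the truncation bridges (`1 < c`, ancient mild with `ν = 1`,
measurable slices, rotated `c`-DSS for `R`, Type-I, not a.e. trivial) whose slices `u t`, `t < 0`,
are all axisymmetric about `e₃`.  SUPPORT for crux `BlowupTypeIDssProfile`
(stmt-NavierStokesRegularity-0155): a witness must break continuous rotational symmetry.
[cite: SereginSverak2009, Thm 1.1 and §1] -/
theorem rdssClass_axisymmetric_empty :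
    ¬ ∃ (c : ℝ) (R : EuclideanSpace ℝ (Fin 3) ≃ₗᵢ[ℝ] EuclideanSpace ℝ (Fin 3)) (u : ℝ → EuclideanSpace ℝ (Fin 3) → EuclideanSpace ℝ (Fin 3)),
      (1 < c ∧ IsAncientMildSolution 1 u ∧ (∀ t < 0, AEStronglyMeasurable (u t) volume) ∧
        IsRotatedDSS c R u ∧ (∃ C₀ : ℝ, HasTypeIDecay C₀ u) ∧ ¬ (∀ t < 0, u t =ᵐ[volume] 0)) ∧
      (∀ t < 0, IsAxisymmetric (u t)) := by
  rintro ⟨c, R, u, ⟨hc, hmild, hmeas, hrdss, hTI, hnz⟩, hax⟩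
  exact hnz (rotatedTypeIDSSLiouville_of_axisymmetric c R u hax hc hmild hmeas hrdss hTI)

end Summit.NavierStokesRegularity.NavierStokesRegularity.Theorems

end
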